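import Summits.ABC.ABC.Theses.DefiniteXi
import Literature.NumberTheory.EllipticCurves.NewformPeterssonSize
import Literature.NumberTheory.EllipticCurves.HeckeOperatorsEigenvalueBoundProofs
import Literature.NumberTheory.EllipticCurves.AnalyticRankProofs

/-!
# Load-bearing analysis of crux `DefiniteXi.PeterssonLowerBound` (stmt-ABC-10870)
# (negative-side support, cdisprove cycle 1)

The crux is verbatim the named fact `murty_petersson_newform_lower_bound`
(`∀ ε > 0, ∃ c > 0`, `c·N^{1-ε} ≤ Re (f,f)_{Γ₀(N)}` for the newform `f` of an elliptic `W/ℚ`,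
`IsNewformOf W f`; Hoffstein–Lockhart 1994 with the Goldfeld–Hoffstein–Lieman appendix). It is a
theorem in print and its constituents (`peterssonProduct` = un-normalised integral for Mathlib's
`dx dy/y²`; `WeierstrassCurve.LFunction` = Euler product of minimal local factors) are typed
faithfully, so no refutation exists; this file records which hypotheses carry the content
(theorems only, no definitions).

* `peterssonLowerBound_false_without_normalisation` — dropping `a₁ = 1` (keeping "new" and
  "Hecke eigenform") makes the statement FALSE: witness `f = 0 ∈ S₂(Γ₀(1))`. Any proof must use the
  normalisation (in the crux it enters twice: `IsNormalized f` inside `IsNewform0 f`, and through the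
  coefficient identity, see the next item).
* `isNormalized_of_forall_cuspCoeff_eq`, `isNewformOf_iff_new_eigen_coeff` — the conjunct
  `IsNormalized f` of `IsNewformOf W f` is REDUNDANT: the coefficient identity `aₙ(f) = aₙ(W)` at
  `n = 1` gives it (`WeierstrassCurve.LFunction_apply_one`).
* `peterssonLowerBound_nonnegConst_trivial` — with `0 ≤ c` in place of `0 < c` the statement is
  trivially true (`c = 0`, `Re (f,f) ≥ 0`): all content is in the positivity of the constant.
* `peterssonLowerBound_uniform_iff_exponentOne` — the quantifier-swapped strengthening
  `∃ c > 0, ∀ ε > 0, …` is EQUIVALENT to the `ε`-free bound `∃ c > 0, c·N ≤ Re (f,f)`, which is false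
  in print (quadratic twists of a fixed curve by many primes with `a_p² ≥ 2p + 1` lose a factor
  `∏_{p∣d}(1 - 1/p) → 0` in `Re(f,f)/N`, by Rankin–Selberg and Sato–Tate); so the order of the
  quantifiers in the crux is essential and the exponent `1 - ε` cannot be improved to `1`
  (paper argument in `Cruxes/PeterssonLowerBound/Disproof.lean`).
-/

noncomputable section

open scoped Real Topology
open Filter CongruenceSubgroup
open Literature.NumberTheory.EllipticCurves.ModularForms

namespace Summit.ABC.ABC.Theorems.PeterssonLowerBound.Negative

/-! ### The normalisation is load-bearing -/

/-- **Any proof of the crux must use `a₁ = 1`.** The crux with the normalisation (and the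
coefficient identity `aₙ(f) = aₙ(W)`, which implies it) dropped — keeping "`f` is new" and "`f` is an
eigenform of every `T_p`" — fails at `f = 0 ∈ S₂(Γ₀(1))`: `0` lies in the kernel-defined new
subspace, is an eigenvector of every `T_p`, and `(0, 0) = 0 < c · 1^{1-ε}`. [folklore] -/
theorem peterssonLowerBound_false_without_normalisation :
    ¬ ∀ ε : ℝ, 0 < ε → ∃ c : ℝ, 0 < c ∧
        ∀ (N : ℕ) [NeZero N] (f : CuspForm (Gamma0 N) 2),
          f ∈ newSubspace0 N 2 → IsHeckeEigenform f →
            c * (N : ℝ) ^ (1 - ε) ≤ (peterssonProduct (Gamma0 N) 2 f f).re := by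
  intro h
  obtain ⟨c, hc, h1⟩ := h 1 one_pos
  have key := h1 1 (0 : CuspForm (Gamma0 1) 2) (Submodule.zero_mem _)
    (fun p hp ↦ ⟨0, by simp⟩)
  rw [peterssonProduct_zero_left] at key
  norm_num at key
  linarith

/-! ### The conjunct `IsNormalized` of `IsNewformOf` is redundant -/

/-- The coefficient identity `aₙ(f) = aₙ(W)` alone forces `a₁(f) = 1`, since `a₁(W) = 1`
(`WeierstrassCurve.LFunction_apply_one`). [folklore] -/
theorem isNormalized_of_forall_cuspCoeff_eq {N : ℕ} [NeZero N] (W : WeierstrassCurve ℚ)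
    (f : CuspForm (Gamma0 N) 2) (h : ∀ n : ℕ, cuspCoeff f n = (W.LFunction n : ℂ)) :
    IsNormalized f := by
  rw [isNormalized_iff_cuspCoeff_one, h 1, W.LFunction_apply_one, Int.cast_one]

/-- `IsNewformOf W f` is equivalent to: `f` new, `f` a Hecke eigenform, and `aₙ(f) = aₙ(W)` for all
`n` — the normalisation conjunct of `IsNewform0` being implied by the coefficient identity.
(Information for provers: one hypothesis fewer to discharge when building the datum.) [folklore] -/
theorem isNewformOf_iff_new_eigen_coeff {N : ℕ} [NeZero N] (W : WeierstrassCurve ℚ)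
    (f : CuspForm (Gamma0 N) 2) :
    IsNewformOf W f ↔
      f ∈ newSubspace0 N 2 ∧ IsHeckeEigenform f ∧ ∀ n : ℕ, cuspCoeff f n = (W.LFunction n : ℂ) := by
  constructor
  · rintro ⟨⟨hnew, heig, -⟩, hcoeff⟩
    exact ⟨hnew, heig, hcoeff⟩
  · rintro ⟨hnew, heig, hcoeff⟩
    exact ⟨⟨hnew, heig, isNormalized_of_forall_cuspCoeff_eq W f hcoeff⟩, hcoeff⟩

/-! ### All content is in `0 < c` -/

/-- With `0 ≤ c` in place of `0 < c` the crux is trivial: `c = 0` and `Re (f,f) ≥ 0`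
(`re_peterssonProduct_self_nonneg_level`). [folklore] -/
theorem peterssonLowerBound_nonnegConst_trivial :
    ∀ ε : ℝ, 0 < ε → ∃ c : ℝ, 0 ≤ c ∧
      ∀ (N : ℕ) [NeZero N] (W : WeierstrassCurve ℚ) [W.IsElliptic] (f : CuspForm (Gamma0 N) 2),
        IsNewformOf W f → c * (N : ℝ) ^ (1 - ε) ≤ (peterssonProduct (Gamma0 N) 2 f f).re := by
  intro ε _
  refine ⟨0, le_rfl, fun N _ W _ f _ ↦ ?_⟩
  rw [zero_mul]
  exact re_peterssonProduct_self_nonneg_level (Gamma0 N) 2 f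

/-! ### The quantifier order: a uniform constant is the same as the `ε`-free bound -/

/-- **The quantifier-swapped crux (`∃ c > 0, ∀ ε > 0`) is equivalent to the `ε`-free bound
`∃ c > 0, c · N ≤ Re (f,f)`** (`→`: let `ε → 0⁺`, `N^{1-ε} → N`; `←`: `N^{1-ε} ≤ N` for `N ≥ 1`).
The `ε`-free bound fails in print (quadratic twists, module docstring), so the dependence of `c` on
`ε` in the crux is essential and `1 - ε` cannot be sharpened to `1`. [folklore] -/
theorem peterssonLowerBound_uniform_iff_exponentOne :
    (∃ c : ℝ, 0 < c ∧ ∀ ε : ℝ, 0 < ε →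
      ∀ (N : ℕ) [NeZero N] (W : WeierstrassCurve ℚ) [W.IsElliptic] (f : CuspForm (Gamma0 N) 2),
        IsNewformOf W f → c * (N : ℝ) ^ (1 - ε) ≤ (peterssonProduct (Gamma0 N) 2 f f).re) ↔
    (∃ c : ℝ, 0 < c ∧
      ∀ (N : ℕ) [NeZero N] (W : WeierstrassCurve ℚ) [W.IsElliptic] (f : CuspForm (Gamma0 N) 2),
        IsNewformOf W f → c * (N : ℝ) ≤ (peterssonProduct (Gamma0 N) 2 f f).re) := by
  constructor
  · rintro ⟨c, hc, h⟩
    refine ⟨c, hc, fun N _ W _ f hf ↦ ?_⟩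
    have hN : (0 : ℝ) < N := Nat.cast_pos.mpr (NeZero.pos N)
    have hcont : Tendsto (fun ε : ℝ ↦ c * (N : ℝ) ^ (1 - ε)) (𝓝[>] 0) (𝓝 (c * N)) := by
      have h1 : Tendsto (fun ε : ℝ ↦ c * (N : ℝ) ^ (1 - ε)) (𝓝 0)
          (𝓝 (c * (N : ℝ) ^ (1 - (0 : ℝ)))) :=
        (continuous_const.mul ((Real.continuous_const_rpow hN.ne').comp
          (continuous_const.sub continuous_id))).tendsto 0
      rw [sub_zero, Real.rpow_one] at h1
      exact h1.mono_left nhdsWithin_le_nhds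
    refine le_of_tendsto hcont ?_
    filter_upwards [self_mem_nhdsWithin] with ε hε
    exact h ε hε N W f hf
  · rintro ⟨c, hc, h⟩
    refine ⟨c, hc, fun ε hε N _ W _ f hf ↦ le_trans ?_ (h N W f hf)⟩
    have hN1 : (1 : ℝ) ≤ N := by exact_mod_cast NeZero.one_le
    refine mul_le_mul_of_nonneg_left ?_ hc.le
    calc (N : ℝ) ^ (1 - ε) ≤ (N : ℝ) ^ (1 : ℝ) :=
          Real.rpow_le_rpow_of_exponent_le hN1 (by linarith)
      _ = N := Real.rpow_one _

end Summit.ABC.ABC.Theorems.PeterssonLowerBound.Negative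

end
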